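import Summits.QuantumFields.YangMills.Theorems.FluctuationComparisonRegPrIntLS2BetaSectionsOfFillings
import Summits.QuantumFields.YangMills.Theorems.FluctuationComparisonRegPrIntLS2BetaSqrtGaugeAssemblyOfSections
import Summits.QuantumFields.YangMills.Theorems.FluctuationComparisonRegPrIntLS2BetaSqrtGaugeFillingTube
import Summits.QuantumFields.YangMills.Theorems.FluctuationComparisonRegPrIntLS2BetaSqrtGaugeFill3
import Summits.QuantumFields.YangMills.Theorems.FluctuationComparisonRegPrIntLS2BetaFlooredSupplierOfSqrtGauge
import HarnessLib

/-!
# S2β · D-GUARD ∕ (BG∞) — (ASSEMBLY-F): ★★ THE CONJECTURED GAUGE LETTER `hBG` AND THE FLOORED SUPPLIER `hsupp` FROM ONE BLOCK-LOCAL FILLING LETTER (STAGE 1, TWO OPPOSITE FACES)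

Cell `ym3-torus` (YM ladder rung R3 = continuum `SU(2)` Yang–Mills on the three-torus at fixed lattice data — a RUNG: NOT d = 4, NOT infinite volume,
NOT a mass gap, NOT Clay).  Width seat `ym-ust-20520-w3` (gen 29) = LEAD-20520 on crux `stmt-QuantumFields-20520` (`FluctuationComparisonRegPrIntL`;
registry `Lines/semiclassical_s2beta.lean` v11 UNTOUCHED, 0∕5); `--kind proof --supports stmt-QuantumFields-20520 --as helper`, count-neutral,
DEFINITION-FREE (0 `def`, 0 `instance`, 0 `notation`, 0 `sorry`, default heartbeats).  The LEAD lineage's first refusal on the FINAL ASSEMBLY of the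
(BG∞) road (desk RULING №127 (P7-D); UV3-NODE §116 + ADD.1 + ADD.2).

WHY.  The (BG∞) road of record reduces the WLOG-gauge supplier side of the FLOORED GAP♯∘ to ONE conjectured letter `hBG` («every `θ`-small `SU(2)` datum on
the `N_J`-torus has a gauge copy with bond arcs `≤ C·√θ + c∕N_J`», LEAD №41 ✓`hsupp_floor_of_sqrtGauge`, w5 ✓`uniformFibreGapOrbit_of_guardedStrata_floor_of_sqrtGauge`).
BY KERNEL on the tree: `hBG` ⟸ `hSec` (✓`hBG_of_sections`) ⟸ {FILL₁, FILL₂, FILL₃} (✓`hSec_of_fillings`); FILL₂ (the tube letter, `∀ E`) IS ✓`fill_tube` and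
FILL₃ (the shell letter, `∀ E`) IS ✓`fill3`.  THIS FILE composes the four by name: `hBG`, and hence the floored `hsupp` letter of ✓`gapStratum_of_goodGauge_floor`
at every gauge-invariant class `G`, follow from the ONE remaining block-local filling letter FILL₁ (two opposite faces, at the single scale `E = 1∕40`) — its
text is the hypothesis `h₁` of ✓`hSec_of_fillings` VERBATIM.

WHAT IS PROVED (sorry-free).  ★`hBG_of_fillings (h₁) : ∃ C c, 0 ≤ C ∧ ⟨hBG⟩` (`:= hBG_of_sections (hSec_of_fillings h₁ fill_tube fill3)`) and
★★`hsupp_floor_of_fillings (G) (hGinv) (hs₀) (h₁) : ⟨the conclusion of ✓`hsupp_floor_of_sqrtGauge`, verbatim⟩` (one `obtain`).  CENSUS EFFECT BY NAME: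
the supplier side of the floored GAP♯∘ text shrinks from the conjecture `hBG` to the single block-local letter FILL₁.

HONEST SCOPE.  Composition by name, zero mathematics of its own.  FILL₁ is a HYPOTHESIS of both theorems; until it is discharged ((L-I) lineage) `hBG`, (BG∞),
`hsupp⁺` and D-GUARD's two floored `hsupp` letters are NOT proved.  Nothing of Bałaban's renormalisation-group
analysis is asserted or proved ([Balaban1985RegularSpaces] Lemma 1 p.79 ∕ (1.29) p.81 ∕ Thm 2 p.83 is the local, non-uniform statement in print; the N-uniform
torus gluing is the cell's (BG∞) plan, NOT in print; [Balaban1985UV3] (1)–(3) p.256, (7) p.257 fix the data lattices and thresholds only).  GAP♯∘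
(`stub_uniformFibreGapOrbit`, registry UNTOUCHED), the five registered stubs (0∕5), S2β, 20520, 19936, 19200, `YM3TorusSU2` are NOT proved; no registered stub is
closed; rung R3 — NOT d = 4, NOT infinite volume, NOT a mass gap, NOT Clay; the Yang–Mills mass gap is NOT proved.  Axioms standard.

References: T. Bałaban, CMP **99** (1985) 75–102 [Balaban1985RegularSpaces] (Lemma 1 p.79, (1.29) p.81, Thm 2 p.83); CMP **102** (1985) 255–275
[Balaban1985UV3] ((1)–(3) p.256, (7) p.257).
-/

set_option autoImplicit false

noncomputable section

namespace Summit.QuantumFields.YangMills.Theorems.FluctuationComparisonRegPrIntLS2BetaFlooredSupplierOfFillings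

open scoped Real
open Literature.MathematicalPhysics.QuantumLattice (su2Quat)
open Literature.MathematicalPhysics.QuantumFieldTheory.Balaban1983to89
open T4CubeChartGnomonic (SU2)
open T4ExpWindowSmallField (logVec)
open T3ContinuumYM3Torus (T3Family)
open T3UnitScaleTilt (θBal)
open Summit.QuantumFields.YangMills.Theorems.FluctuationComparisonRegPrIntLS2BetaSectionsOfFillings (hSec_of_fillings)
open Summit.QuantumFields.YangMills.Theorems.FluctuationComparisonRegPrIntLS2BetaSqrtGaugeAssemblyOfSections (hBG_of_sections)
open Summit.QuantumFields.YangMills.Theorems.FluctuationComparisonRegPrIntLS2BetaSqrtGaugeFillingTube (fill_tube)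
open Summit.QuantumFields.YangMills.Theorems.FluctuationComparisonRegPrIntLS2BetaSqrtGaugeFill3 (fill3)
open Summit.QuantumFields.YangMills.Theorems.FluctuationComparisonRegPrIntLS2BetaFlooredSupplierOfSqrtGauge (hsupp_floor_of_sqrtGauge)

/-! ## §1 The conjectured gauge letter from the one remaining filling letter -/

/-- ★ **`hBG` FROM FILL₁** (FILL₂ and FILL₃ consumed by name: ✓`fill_tube`, ✓`fill3`): the N-uniform small-bond gauge letter of the (BG∞) road, with its
constants `C, c` exhibited, from the stage-1 filling letter at `E = 1∕40` — `hBG_of_sections ∘ hSec_of_fillings`.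
[cite: Balaban1985RegularSpaces, Lemma 1 p.79, (1.29) p.81, Thm 2 p.83] -/
theorem hBG_of_fillings
    (h₁ : ∃ A : ℝ, ∃ ρ₀ : ℕ, ∀ (P : Params), P.d = 3 → ∀ ρ : ℕ, ρ₀ ≤ ρ → 8 * ρ ≤ P.sitesPerDir 0 →
      ∀ (n s : Fin P.d → ℕ), (∀ κ, ρ ≤ n κ ∧ 3 * n κ ≤ 4 * ρ + 3) →
      ∀ (α : Fin P.d) (ψ : Site P 0 → SU2) (ε : ℝ), ∃ W : Site P 0 → SU2,
        (∀ x : Site P 0, (∀ κ, (x κ - ((s κ : ℕ) : ZMod (P.sitesPerDir 0))).val ≤ n κ) →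
          ((x α - ((s α : ℕ) : ZMod (P.sitesPerDir 0))).val = 0 ∨ (x α - ((s α : ℕ) : ZMod (P.sitesPerDir 0))).val = n α) → W x = ψ x) ∧
        ((0 ≤ ε ∧ ε * ρ ≤ 1 / 40 ∧ ∀ b : PBond P 0, (∀ κ, (b.src κ - ((s κ : ℕ) : ZMod (P.sitesPerDir 0))).val ≤ n κ) →
            (∀ κ, (b.tgt κ - ((s κ : ℕ) : ZMod (P.sitesPerDir 0))).val ≤ n κ) →
            ((b.src α - ((s α : ℕ) : ZMod (P.sitesPerDir 0))).val = 0 ∨ (b.src α - ((s α : ℕ) : ZMod (P.sitesPerDir 0))).val = n α) →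
            ((b.tgt α - ((s α : ℕ) : ZMod (P.sitesPerDir 0))).val = 0 ∨ (b.tgt α - ((s α : ℕ) : ZMod (P.sitesPerDir 0))).val = n α) →
            dist1 (ψ b.src * (ψ b.tgt)⁻¹) ≤ ε) →
          ∀ b : PBond P 0, (∀ κ, (b.src κ - ((s κ : ℕ) : ZMod (P.sitesPerDir 0))).val ≤ n κ) →
            (∀ κ, (b.tgt κ - ((s κ : ℕ) : ZMod (P.sitesPerDir 0))).val ≤ n κ) →
            dist1 (W b.src * (W b.tgt)⁻¹) ≤ A / ρ)) :
    ∃ C c : ℝ, 0 ≤ C ∧ ∀ (F : T3Family) (J : ℕ) (θ : ℝ), 0 < θ → ∀ V : GaugeField (F.P J) 0 (Matrix.specialUnitaryGroup (Fin 2) ℂ), PlaqSmall θ V →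
      ∃ u : GaugeTransf (F.P J) 0 (Matrix.specialUnitaryGroup (Fin 2) ℂ),
        ∀ e, ‖logVec (su2Quat (GaugeField.gaugeAct u V e))‖ ≤ C * Real.sqrt θ + c / (((F.P J).sitesPerDir 0 : ℕ) : ℝ) :=
  hBG_of_sections (hSec_of_fillings h₁ fill_tube fill3)

/-! ## §2 The floored supplier letter from the one remaining filling letter -/

/-- ★★ **THE FLOORED SUPPLIER LETTER FROM FILL₁**: for every gauge-invariant class `G`, the `hsupp` binder of ✓`gapStratum_of_goodGauge_floor` at
`G′ := G ∧ (∀ e, arc ≤ s₀)` — the conclusion of ✓`hsupp_floor_of_sqrtGauge` verbatim (floor `J₀` from `θBal → 0` and `N_J ≥ J + 1`) — with the conjectured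
gauge letter `hBG` replaced by the one block-local filling letter.  One `obtain` over ★`hBG_of_fillings`.
[cite: Balaban1985UV3, (3) p.256 and (7) p.257; Balaban1985RegularSpaces, (1.29) p.81, Thm 2 p.83] -/
theorem hsupp_floor_of_fillings
    (G : (F : T3Family) → (J : ℕ) → GaugeField (F.P J) 0 (Matrix.specialUnitaryGroup (Fin 2) ℂ) → Prop)
    (hGinv : ∀ (F : T3Family) (J : ℕ) (u : GaugeTransf (F.P J) 0 (Matrix.specialUnitaryGroup (Fin 2) ℂ))
      (V : GaugeField (F.P J) 0 (Matrix.specialUnitaryGroup (Fin 2) ℂ)), G F J V → G F J (GaugeField.gaugeAct u V))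
    {s₀ : ℝ} (hs₀ : 0 < s₀)
    (h₁ : ∃ A : ℝ, ∃ ρ₀ : ℕ, ∀ (P : Params), P.d = 3 → ∀ ρ : ℕ, ρ₀ ≤ ρ → 8 * ρ ≤ P.sitesPerDir 0 →
      ∀ (n s : Fin P.d → ℕ), (∀ κ, ρ ≤ n κ ∧ 3 * n κ ≤ 4 * ρ + 3) →
      ∀ (α : Fin P.d) (ψ : Site P 0 → SU2) (ε : ℝ), ∃ W : Site P 0 → SU2,
        (∀ x : Site P 0, (∀ κ, (x κ - ((s κ : ℕ) : ZMod (P.sitesPerDir 0))).val ≤ n κ) →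
          ((x α - ((s α : ℕ) : ZMod (P.sitesPerDir 0))).val = 0 ∨ (x α - ((s α : ℕ) : ZMod (P.sitesPerDir 0))).val = n α) → W x = ψ x) ∧
        ((0 ≤ ε ∧ ε * ρ ≤ 1 / 40 ∧ ∀ b : PBond P 0, (∀ κ, (b.src κ - ((s κ : ℕ) : ZMod (P.sitesPerDir 0))).val ≤ n κ) →
            (∀ κ, (b.tgt κ - ((s κ : ℕ) : ZMod (P.sitesPerDir 0))).val ≤ n κ) →
            ((b.src α - ((s α : ℕ) : ZMod (P.sitesPerDir 0))).val = 0 ∨ (b.src α - ((s α : ℕ) : ZMod (P.sitesPerDir 0))).val = n α) →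
            ((b.tgt α - ((s α : ℕ) : ZMod (P.sitesPerDir 0))).val = 0 ∨ (b.tgt α - ((s α : ℕ) : ZMod (P.sitesPerDir 0))).val = n α) →
            dist1 (ψ b.src * (ψ b.tgt)⁻¹) ≤ ε) →
          ∀ b : PBond P 0, (∀ κ, (b.src κ - ((s κ : ℕ) : ZMod (P.sitesPerDir 0))).val ≤ n κ) →
            (∀ κ, (b.tgt κ - ((s κ : ℕ) : ZMod (P.sitesPerDir 0))).val ≤ n κ) →
            dist1 (W b.src * (W b.tgt)⁻¹) ≤ A / ρ)) :
    ∀ (L : ℕ), ∃ c₀ : ℝ, 0 < c₀ ∧ c₀ ≤ 1 ∧ ∀ (cw : ℝ), 0 < cw → cw ≤ c₀ → ∃ pS : ℝ, ∀ (b₀ p₀ : ℝ), 0 < b₀ → pS ≤ p₀ → 0 < p₀ →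
      ∃ γ₁ : ℝ, 0 < γ₁ ∧ ∀ (F : T3Family) (γ : ℝ), F.L = L → 0 < γ → γ ≤ γ₁ → ∃ J₀ : ℕ,
        ∀ (J : ℕ) (hJ₀ : J₀ ≤ J) (V : GaugeField (F.P J) 0 (Matrix.specialUnitaryGroup (Fin 2) ℂ)), PlaqSmall (θBal F.L γ (cw * b₀) p₀ J) V → G F J V →
          ∃ u : GaugeTransf (F.P J) 0 (Matrix.specialUnitaryGroup (Fin 2) ℂ),
            G F J (GaugeField.gaugeAct u V) ∧ ∀ e, ‖logVec (su2Quat (GaugeField.gaugeAct u V e))‖ ≤ s₀ := by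
  obtain ⟨C, c, hC, hBG⟩ := hBG_of_fillings h₁
  exact hsupp_floor_of_sqrtGauge G hGinv hs₀ hC hBG

end Summit.QuantumFields.YangMills.Theorems.FluctuationComparisonRegPrIntLS2BetaFlooredSupplierOfFillings

end
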